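import Summits.ResolutionOfSingularities.ResolutionOfSingularities.Theorems.HilbertStallClasses
import HarnessLib

/-!
# HilbertStall — base change and DESCENT of the stall index through field extensions

Node «HilbertStall» (decomp-res lens-3, g31), edge E4.  For a field extension `K → K'`:
* `hasseDeriv_map`, `topIdeal_map`: the top ideal of `F ⊗ K'` is the extension of the top ideal of `F`;
* `isolatedTop_map`: isolation ascends;
* `stall_descent`: `Stall q (F ⊗ K') k → Stall q F k` — a `K`-linear retraction `φ : K' → K` applied coefficientwise
  (`retract φ`) is additive, fixes `K[x]`, is `K[x]`-linear on products `p' · (p ⊗ 1)`, and preserves `𝔪`-adic order,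
  so it carries a stall identity over `K'` down to one over `K`.
Used by the Law slice to pass from `K` to `AlgebraicClosure K` and back (the residual ports are stated over
algebraically closed fields only).
-/

set_option linter.dupNamespace false

noncomputable section

open MvPolynomial
open Literature.AlgebraicGeometry.Resolution
open Summit.ResolutionOfSingularities.ResolutionOfSingularities.Theorems.TightDefectClasses
open Summit.ResolutionOfSingularities.ResolutionOfSingularities.Theorems.UltraWalk

namespace Summit.ResolutionOfSingularities.ResolutionOfSingularities.Theorems.HilbertStall

/-! ## §1 Base change of Hasse derivatives, top ideals, isolation -/

section BaseChange

variable {σ : Type} {K K' : Type} [CommRing K] [CommRing K']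

/-- Hasse derivatives commute with coefficientwise ring maps. [folklore] -/
theorem hasseDeriv_map [DecidableEq σ] (f : K →+* K') (d : σ →₀ ℕ) (F : MvPolynomial σ K) :
    hasseDeriv K' d (map f F) = map f (hasseDeriv K d F) := by
  ext β
  rw [coeff_hasseDeriv, coeff_map, coeff_map, coeff_hasseDeriv, map_mul, map_natCast]

/-- `map f` does not increase the `𝔪`-adic order: `x ∈ 𝔪^n → map f x ∈ 𝔪'^n`. [folklore] -/
theorem map_mem_pow_idealOfVars (f : K →+* K') {n : ℕ} {x : MvPolynomial σ K} (hx : x ∈ idealOfVars σ K ^ n) :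
    map f x ∈ idealOfVars σ K' ^ n := by
  rw [mem_pow_idealOfVars_iff] at hx ⊢
  exact fun c hc => hx c (support_map_subset f x hc)

end BaseChange

section BaseChangeField

variable {σ : Type} {K K' : Type} [Field K] [Field K']

/-- The top ideal of the base change is the extended top ideal. [folklore] -/
theorem topIdeal_map (f : K →+* K') (q : ℕ) (F : MvPolynomial σ K) :
    topIdeal q (map f F) = Ideal.map (MvPolynomial.map f) (topIdeal q F) := by
  classical
  have h : (fun d : σ →₀ ℕ => hasseDeriv K' d (map f F)) = (MvPolynomial.map f) ∘ fun d => hasseDeriv K d F :=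
    funext fun d => hasseDeriv_map f d F
  unfold topIdeal
  rw [h, Set.image_comp, Ideal.map_span]

/-- Isolation of the origin ASCENDS along a field extension. [folklore] -/
theorem isolatedTop_map (f : K →+* K') {q : ℕ} {F : MvPolynomial σ K} (h : IsolatedTop q F) :
    IsolatedTop q (map f F) := by
  obtain ⟨N, g, hg, hmem⟩ := h
  refine ⟨N, map f g, ?_, fun i => ?_⟩
  · rw [constantCoeff_map]; exact (map_ne_zero f).mpr hg
  · have h1 := Ideal.mem_map_of_mem (MvPolynomial.map f) (hmem i)
    rw [map_mul, map_pow, map_X] at h1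
    rwa [topIdeal_map]

/-- Degrees do not grow under base change. [folklore] -/
theorem totalDegree_map_le_of_le (f : K →+* K') {F : MvPolynomial σ K} {D : ℕ} (hF : F.totalDegree ≤ D) :
    (map f F).totalDegree ≤ D :=
  le_trans (Finset.sup_mono (support_map_subset f F)) hF

end BaseChangeField

/-! ## §2 The coefficientwise retraction -/

section Retract

variable {σ : Type} {K K' : Type} [Field K] [Field K'] [Algebra K K'] (φ : K' →ₗ[K] K)

/-- Coefficientwise application of a `K`-linear map `φ : K' → K` (raw function). DEFINITION (support). [folklore] -/
def retractFun (p : MvPolynomial σ K') : MvPolynomial σ K := ∑ c ∈ p.support, monomial c (φ (coeff c p))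

/-- Coefficients of the retraction. [folklore] -/
theorem coeff_retractFun (p : MvPolynomial σ K') (c : σ →₀ ℕ) : coeff c (retractFun φ p) = φ (coeff c p) := by
  classical
  rw [retractFun, coeff_sum]
  simp_rw [coeff_monomial]
  rw [Finset.sum_ite_eq']
  split_ifs with hc
  · rfl
  · rw [notMem_support_iff.mp hc, map_zero]

/-- The coefficientwise RETRACTION as an additive map. DEFINITION (support). [folklore] -/
def retract : MvPolynomial σ K' →+ MvPolynomial σ K where
  toFun := retractFun φ
  map_zero' := by ext c; rw [coeff_retractFun, coeff_zero, coeff_zero, map_zero]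
  map_add' p p' := by ext c; rw [coeff_add, coeff_retractFun, coeff_retractFun, coeff_retractFun, coeff_add, map_add]

/-- Coefficients of the retraction. [folklore] -/
theorem coeff_retract (p : MvPolynomial σ K') (c : σ →₀ ℕ) : coeff c (retract φ p) = φ (coeff c p) :=
  coeff_retractFun φ p c

/-- A retraction of the structure map fixes `K[x]`. [folklore] -/
theorem retract_map (hφ : ∀ x : K, φ (algebraMap K K' x) = x) (p : MvPolynomial σ K) :
    retract φ (map (algebraMap K K') p) = p := by
  ext c; rw [coeff_retract, coeff_map, hφ]

/-- The retraction is `K[x]`-linear on products with base-changed polynomials. [folklore] -/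
theorem retract_mul_map (p' : MvPolynomial σ K') (p : MvPolynomial σ K) :
    retract φ (p' * map (algebraMap K K') p) = retract φ p' * p := by
  classical
  ext c
  rw [coeff_retract, coeff_mul, coeff_mul, map_sum]
  refine Finset.sum_congr rfl fun x _ => ?_
  rw [coeff_map, coeff_retract, mul_comm (coeff x.1 p'), ← Algebra.smul_def, map_smul, smul_eq_mul, mul_comm]

/-- The retraction preserves `𝔪`-adic order. [folklore] -/
theorem retract_mem_pow {n : ℕ} {p' : MvPolynomial σ K'} (h : p' ∈ idealOfVars σ K' ^ n) :
    retract φ p' ∈ idealOfVars σ K ^ n := by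
  rw [mem_pow_idealOfVars_iff] at h ⊢
  intro c hc
  refine h c ?_
  rw [mem_support_iff] at hc ⊢
  intro h0
  exact hc (by rw [coeff_retract, h0, map_zero])

end Retract

/-! ## §3 Descent of the stall index -/

section Descent

variable {σ : Type} [DecidableEq σ] [Fintype σ] {K K' : Type} [Field K] [Field K'] [Algebra K K']

/-- A `K`-linear retraction of the structure map of a field extension exists. [folklore] -/
theorem exists_retraction : ∃ φ : K' →ₗ[K] K, ∀ x : K, φ (algebraMap K K' x) = x := by
  have hinj : LinearMap.ker (Algebra.linearMap K K') = ⊥ :=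
    LinearMap.ker_eq_bot.mpr fun x y h => (algebraMap K K').injective h
  obtain ⟨φ, hφ⟩ := (Algebra.linearMap K K').exists_leftInverse_of_injective hinj
  exact ⟨φ, fun x => by simpa using LinearMap.congr_fun hφ x⟩

/-- **DESCENT OF THE STALL (E4).**  If the top ideal of `F ⊗_K K'` stalls at index `k`, so does the top ideal of `F`:
apply a coefficientwise `K`-linear retraction to a stall identity over `K'`. [folklore] -/
theorem stall_descent {q k : ℕ} {F : MvPolynomial σ K} (h : Stall q (map (algebraMap K K') F) k) : Stall q F k := by
  obtain ⟨φ, hφ⟩ := exists_retraction (K := K) (K' := K')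
  intro x hx
  have hx' : map (algebraMap K K') x ∈ idealOfVars σ K' ^ k := map_mem_pow_idealOfVars _ hx
  obtain ⟨j, hj, r, hr, hjr⟩ := Submodule.mem_sup.mp (h hx')
  rw [topIdeal_eq_span_range, Submodule.mem_span_range_iff_exists_fun] at hj
  obtain ⟨u, hu⟩ := hj
  have hx_eq : x = retract φ j + retract φ r := by
    rw [← map_add, hjr, retract_map φ hφ]
  rw [hx_eq]
  refine Submodule.add_mem_sup ?_ (retract_mem_pow φ hr)
  rw [← hu, map_sum]
  refine Ideal.sum_mem _ fun a _ => ?_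
  rw [smul_eq_mul, hasseDeriv_map, retract_mul_map]
  refine Ideal.mul_mem_left _ _ (Ideal.subset_span ⟨(a : σ →₀ ℕ), ?_, rfl⟩)
  exact (mem_hasseIndex.mp a.2)

/-- **DESCENT, packaged with ascent of the hypotheses**: to prove `Stall q F k` for `F` over `K` with an isolated top
one may pass to any extension field (e.g. `AlgebraicClosure K`). [folklore] -/
theorem stall_of_stall_map {q k : ℕ} {F : MvPolynomial σ K}
    (h : IsolatedTop q (map (algebraMap K K') F) → Stall q (map (algebraMap K K') F) k) (hF : IsolatedTop q F) :
    Stall q F k :=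
  stall_descent (h (isolatedTop_map (algebraMap K K') hF))

end Descent

end Summit.ResolutionOfSingularities.ResolutionOfSingularities.Theorems.HilbertStall

end
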